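import Summits.QuantumFields.YangMills.Theorems.ColdStartUniversalityShenZhuZhuQuaternionRetractionSU2
import Mathlib.Analysis.SpecialFunctions.SmoothTransition
import HarnessLib

/-!
# Extending a function on `SU(2)^E` to the real link coordinates via the quaternionic retraction, I: `F̃(x) = χ(x)·F(π(x))` near the group

Seat `ym-line-csu-p1` (g41), route `ColdStartUniversality` of `Summits/QuantumFields/YangMills`, helper file G52 (`--supports stmt-QuantumFields-24809`).
Third brick of the all-Lipschitz extension of the `ρ_L`-contraction (G44).  For `F : SU(2)^E → ℝ` put `F̃(x) = χ(x)·F(π(x))` on the coordinate space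
`X = (E × 2 × 2 × Bool → ℝ)`, where `π(x)_e = √2·𝖯M_e(x)/|𝖯M_e(x)|` is the quaternionic retraction (G50) of the `e`-th link matrix `M_e(x)` rebuilt from
`x` (junk `1` where `𝖯M_e(x) = 0`) and `χ(x) = Π_e ψ(8|𝖯M_e(x)|² − 1)` is a smooth cut-off (`ψ = Real.smoothTransition`: the factor is `0` for
`|𝖯M_e(x)|² ≤ 1/8` and `1` for `|𝖯M_e(x)|² ≥ 1/4`).  This file: the algebra of rebuilding and the behaviour within sup-distance `1/4` of the group.

* `rebuild_coords_two` (`M_e(coords Q) = Q_e`), `rebuild_sub` (linearity), `hsForm_rebuild_le` (`|M_e(t)|² ≤ 8‖t‖_∞²`), `sqrt_hsForm_sub_ge` (reverse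
  triangle inequality for `|·|_HS`);
* ★ `quatProj_rebuild_near` — for `‖x − coords Q‖_∞ ≤ r`: `𝖯M_e(x) = Q_e − 𝖯M_e(coords Q − x)`, `|𝖯M_e(coords Q − x)|² ≤ 8r²`, `|𝖯M_e(x)| ≥ √2(1 − 2r)`;
* ★ `retr_near` — for `‖x − coords Q‖_∞ ≤ 1/4`: `|𝖯M_e(x)|² ≥ 1/2`, `χ(x) = 1`, and `π(x)_e = √2·𝖯M_e(x)/|𝖯M_e(x)|` (no junk branch);
* ★ `ext_coords` — `π(coords Q) = Q` and `F̃(coords Q) = F(Q)`.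

The modulus of continuity, the local `ρ_L`-dilatation `1/(1 − 2r)` of `π` and the continuity of `F̃` follow in part II.
THEOREMS ONLY, no definition (all objects are `let`-bound in the statements), no sorry.  HONEST FRAMING: finite-dimensional analysis on `SU(2)^E`;
nothing about the route's scaling; `UniformColdStartMixing` (24809, ASIDE) not restated; no crux, rung or summit statement is proved; the Yang–Mills
mass gap is NOT proved.
-/

set_option autoImplicit false

noncomputable section

namespace Summit.QuantumFields.YangMills.Theorems.ColdStartUniversality

open MeasureTheory Matrix Complex Finset Filter Topology Set
open scoped ComplexConjugate BigOperators Real NNReal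
open Literature.MathematicalPhysics.QuantumFieldTheory
open Literature.MathematicalPhysics.QuantumLattice (fundamentalRep fundamentalLatticeRep continuous_fundamentalRep fundamentalRep_apply fundamentalLatticeRep_N)

variable {L : ℕ} [NeZero L]

/-! ## §1. Rebuilding link matrices from coordinates -/

omit [NeZero L] in
/-- `M_e(coords Q) = Q_e`. [folklore] -/
theorem rebuild_coords_two (Q : GaugeConfig 3 L (Matrix.specialUnitaryGroup (Fin 2) ℂ)) (e : Edge 3 L) :
    (Matrix.of fun i j : Fin 2 =>
        (((fun q : Edge 3 L × Fin 2 × Fin 2 × Bool => (fun z : ℂ => if q.2.2.2 then z.im else z.re) ((fundamentalRep (Fin 2) (Q q.1) : Matrix (Fin 2) (Fin 2) ℂ) q.2.1 q.2.2.1))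
          (e, i, j, false) : ℝ) : ℂ) +
        (((fun q : Edge 3 L × Fin 2 × Fin 2 × Bool => (fun z : ℂ => if q.2.2.2 then z.im else z.re) ((fundamentalRep (Fin 2) (Q q.1) : Matrix (Fin 2) (Fin 2) ℂ) q.2.1 q.2.2.1))
          (e, i, j, true) : ℝ) : ℂ) * Complex.I) = (Q e : Matrix (Fin 2) (Fin 2) ℂ) := by
  ext i j
  simp only [Matrix.of_apply, Bool.false_eq_true, if_false, if_true, fundamentalRep_apply]
  exact Complex.re_add_im _

omit [NeZero L] in
/-- `M_e(x − t) = M_e(x) − M_e(t)` (rebuilding is linear). [folklore] -/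
theorem rebuild_sub (x t : Edge 3 L × Fin 2 × Fin 2 × Bool → ℝ) (e : Edge 3 L) :
    (Matrix.of fun i j : Fin 2 => (((x - t) (e, i, j, false) : ℝ) : ℂ) + (((x - t) (e, i, j, true) : ℝ) : ℂ) * Complex.I) =
      (Matrix.of fun i j : Fin 2 => ((x (e, i, j, false) : ℝ) : ℂ) + ((x (e, i, j, true) : ℝ) : ℂ) * Complex.I) -
      (Matrix.of fun i j : Fin 2 => ((t (e, i, j, false) : ℝ) : ℂ) + ((t (e, i, j, true) : ℝ) : ℂ) * Complex.I) := by
  ext i j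
  simp only [Matrix.of_apply, Matrix.sub_apply, Pi.sub_apply, Complex.ofReal_sub]
  ring

/-- `|M_e(t)|² ≤ 8‖t‖_∞²` (four complex entries, each of squared modulus `≤ 2‖t‖_∞²`). [folklore] -/
theorem hsForm_rebuild_le (t : Edge 3 L × Fin 2 × Fin 2 × Bool → ℝ) (e : Edge 3 L) :
    hsForm 2 (Matrix.of fun i j : Fin 2 => ((t (e, i, j, false) : ℝ) : ℂ) + ((t (e, i, j, true) : ℝ) : ℂ) * Complex.I)
      (Matrix.of fun i j : Fin 2 => ((t (e, i, j, false) : ℝ) : ℂ) + ((t (e, i, j, true) : ℝ) : ℂ) * Complex.I) ≤ 8 * ‖t‖ ^ 2 := by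
  rw [hsForm_self]
  have hent : ∀ i j : Fin 2, ‖((t (e, i, j, false) : ℝ) : ℂ) + ((t (e, i, j, true) : ℝ) : ℂ) * Complex.I‖ ^ 2 ≤ 2 * ‖t‖ ^ 2 := by
    intro i j
    rw [Complex.sq_norm, Complex.normSq_apply]
    simp only [Complex.add_re, Complex.ofReal_re, Complex.mul_re, Complex.I_re, mul_zero, Complex.ofReal_im, Complex.I_im, mul_one,
      sub_self, add_zero, Complex.add_im, Complex.mul_im, zero_add]
    have h1 : |t (e, i, j, false)| ≤ ‖t‖ := by rw [← Real.norm_eq_abs]; exact norm_le_pi_norm t _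
    have h2 : |t (e, i, j, true)| ≤ ‖t‖ := by rw [← Real.norm_eq_abs]; exact norm_le_pi_norm t _
    have h1' := sq_le_sq' (abs_le.1 h1).1 (abs_le.1 h1).2
    have h2' := sq_le_sq' (abs_le.1 h2).1 (abs_le.1 h2).2
    nlinarith
  simp only [Matrix.of_apply, Fin.sum_univ_two]
  linarith [hent 0 0, hent 0 1, hent 1 0, hent 1 1]

/-- Reverse triangle inequality for the Hilbert–Schmidt norm: `√|A − B|² ≥ √|A|² − √|B|²`. [folklore] -/
theorem sqrt_hsForm_sub_ge (A B : Matrix (Fin 2) (Fin 2) ℂ) :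
    Real.sqrt (hsForm 2 A A) - Real.sqrt (hsForm 2 B B) ≤ Real.sqrt (hsForm 2 (A - B) (A - B)) := by
  -- through the Euclidean coordinate vector of G45
  have hn : ∀ X : Matrix (Fin 2) (Fin 2) ℂ, Real.sqrt (hsForm 2 X X) =
      ‖(WithLp.toLp 2 (fun q : Fin 2 × Fin 2 × Bool => if q.2.2 then (X q.1 q.2.1).im else (X q.1 q.2.1).re) : EuclideanSpace ℝ (Fin 2 × Fin 2 × Bool))‖ := by
    intro X
    rw [← inner_toLp_reIm_eq_hsForm, real_inner_self_eq_norm_sq, Real.sqrt_sq (norm_nonneg _)]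
  rw [hn, hn, hn]
  have hsub : (WithLp.toLp 2 (fun q : Fin 2 × Fin 2 × Bool => if q.2.2 then ((A - B) q.1 q.2.1).im else ((A - B) q.1 q.2.1).re) :
      EuclideanSpace ℝ (Fin 2 × Fin 2 × Bool)) =
      (WithLp.toLp 2 (fun q : Fin 2 × Fin 2 × Bool => if q.2.2 then (A q.1 q.2.1).im else (A q.1 q.2.1).re) : EuclideanSpace ℝ (Fin 2 × Fin 2 × Bool)) -
      WithLp.toLp 2 (fun q : Fin 2 × Fin 2 × Bool => if q.2.2 then (B q.1 q.2.1).im else (B q.1 q.2.1).re) := by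
    rw [← WithLp.toLp_sub]; congr 1; funext q
    obtain ⟨i, j, b⟩ := q; cases b <;> simp [Matrix.sub_apply]
  rw [hsub]
  exact (le_abs_self _).trans (abs_norm_sub_norm_le _ _)

/-! ## §2. Near the group: the retraction is given by the normalised quaternionic projection and the cut-off is `1` -/

/-- ★ **The link matrices near the group.**  For `x` with `‖x − coords Q‖_∞ ≤ r ≤ 1/4` and every link `e`: `𝖯M_e(x) = Q_e − 𝖯M_e(coords Q − x)`,
`|𝖯M_e(coords Q − x)|² ≤ 8r²` and `|𝖯M_e(x)| ≥ √2(1 − 2r) ≥ √2/2`. [folklore] -/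
theorem quatProj_rebuild_near
    (Q : GaugeConfig 3 L (Matrix.specialUnitaryGroup (Fin 2) ℂ)) (x : Edge 3 L × Fin 2 × Fin 2 × Bool → ℝ) {r : ℝ} :
    let coords : GaugeConfig 3 L (Matrix.specialUnitaryGroup (Fin 2) ℂ) → (Edge 3 L × Fin 2 × Fin 2 × Bool → ℝ) :=
      fun V q => (fun z : ℂ => if q.2.2.2 then z.im else z.re) ((fundamentalRep (Fin 2) (V q.1) : Matrix (Fin 2) (Fin 2) ℂ) q.2.1 q.2.2.1)
    let rebuild : (Edge 3 L × Fin 2 × Fin 2 × Bool → ℝ) → Edge 3 L → Matrix (Fin 2) (Fin 2) ℂ :=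
      fun x e => Matrix.of fun i j : Fin 2 => ((x (e, i, j, false) : ℝ) : ℂ) + ((x (e, i, j, true) : ℝ) : ℂ) * Complex.I
    let qP : Matrix (Fin 2) (Fin 2) ℂ → Matrix (Fin 2) (Fin 2) ℂ := fun M =>
      !![(M 0 0 + conj (M 1 1)) / 2, (M 0 1 - conj (M 1 0)) / 2; -conj ((M 0 1 - conj (M 1 0)) / 2), conj ((M 0 0 + conj (M 1 1)) / 2)]
    ‖x - coords Q‖ ≤ r → ∀ e : Edge 3 L,
      qP (rebuild x e) = (fundamentalRep (Fin 2) (Q e) : Matrix (Fin 2) (Fin 2) ℂ) - qP (rebuild (coords Q - x) e) ∧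
      hsForm 2 (qP (rebuild (coords Q - x) e)) (qP (rebuild (coords Q - x) e)) ≤ 8 * r ^ 2 ∧
      Real.sqrt 2 * (1 - 2 * r) ≤ Real.sqrt (hsForm 2 (qP (rebuild x e)) (qP (rebuild x e))) := by
  intro coords rebuild qP hx e
  have hr0 : 0 ≤ r := le_trans (norm_nonneg _) hx
  -- linearity: `rebuild x = rebuild (coords Q) − rebuild (coords Q − x)` and `𝖯` is additive
  have hreb : rebuild x e = rebuild (coords Q) e - rebuild (coords Q - x) e := by
    have h := rebuild_sub (coords Q) (coords Q - x) e
    simp only [sub_sub_cancel] at h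
    -- `h : rebuild x e = rebuild (coords Q) e - rebuild (coords Q - x) e` up to unfolding
    exact h
  have hQ : rebuild (coords Q) e = (fundamentalRep (Fin 2) (Q e) : Matrix (Fin 2) (Fin 2) ℂ) := rebuild_coords_two Q e
  have hPsub : qP (rebuild x e) = qP (rebuild (coords Q) e) - qP (rebuild (coords Q - x) e) := by
    rw [hreb]
    have h := quatProj_sub (rebuild (coords Q) e) (rebuild (coords Q - x) e)
    exact h.symm ▸ rfl
  have hPQ : qP (rebuild (coords Q) e) = (fundamentalRep (Fin 2) (Q e) : Matrix (Fin 2) (Fin 2) ℂ) := by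
    rw [hQ]; exact quatProj_coe_two (Q e)
  have h1 : qP (rebuild x e) = (fundamentalRep (Fin 2) (Q e) : Matrix (Fin 2) (Fin 2) ℂ) - qP (rebuild (coords Q - x) e) := by rw [hPsub, hPQ]
  -- size of the perturbation
  have hT : hsForm 2 (qP (rebuild (coords Q - x) e)) (qP (rebuild (coords Q - x) e)) ≤ 8 * r ^ 2 := by
    have hP := hsForm_quatProj_le (rebuild (coords Q - x) e)
    have hR := hsForm_rebuild_le (coords Q - x) e
    have hn : ‖coords Q - x‖ ≤ r := by rw [norm_sub_rev]; exact hx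
    have hn2 : ‖coords Q - x‖ ^ 2 ≤ r ^ 2 := pow_le_pow_left₀ (norm_nonneg _) hn 2
    exact hP.trans (hR.trans (by nlinarith))
  refine ⟨h1, hT, ?_⟩
  -- reverse triangle inequality
  have hQn : Real.sqrt (hsForm 2 (fundamentalRep (Fin 2) (Q e) : Matrix (Fin 2) (Fin 2) ℂ) (fundamentalRep (Fin 2) (Q e) : Matrix (Fin 2) (Fin 2) ℂ)) = Real.sqrt 2 := by
    rw [hsForm_self_fundamentalRep]
  have hTn : Real.sqrt (hsForm 2 (qP (rebuild (coords Q - x) e)) (qP (rebuild (coords Q - x) e))) ≤ 2 * Real.sqrt 2 * r := by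
    calc Real.sqrt (hsForm 2 (qP (rebuild (coords Q - x) e)) (qP (rebuild (coords Q - x) e))) ≤ Real.sqrt (8 * r ^ 2) := Real.sqrt_le_sqrt hT
      _ = 2 * Real.sqrt 2 * r := by
          rw [show (8 : ℝ) * r ^ 2 = (2 * Real.sqrt 2 * r) ^ 2 by rw [mul_pow, mul_pow, Real.sq_sqrt (by norm_num : (0:ℝ) ≤ 2)]; ring,
            Real.sqrt_sq (mul_nonneg (mul_nonneg (by norm_num) (Real.sqrt_nonneg 2)) hr0)]
  have hrev := sqrt_hsForm_sub_ge (fundamentalRep (Fin 2) (Q e) : Matrix (Fin 2) (Fin 2) ℂ) (qP (rebuild (coords Q - x) e))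
  rw [← h1, hQn] at hrev
  calc Real.sqrt 2 * (1 - 2 * r) = Real.sqrt 2 - 2 * Real.sqrt 2 * r := by ring
    _ ≤ Real.sqrt 2 - Real.sqrt (hsForm 2 (qP (rebuild (coords Q - x) e)) (qP (rebuild (coords Q - x) e))) := by linarith
    _ ≤ Real.sqrt (hsForm 2 (qP (rebuild x e)) (qP (rebuild x e))) := hrev

/-- ★ **The retraction and the cut-off near the group.**  For `‖x − coords Q‖_∞ ≤ 1/4`: every `|𝖯M_e(x)|² ≥ 1/2`, the cut-off equals `1`, and the
`e`-th component of `π(x)` is the matrix `√2·𝖯M_e(x)/|𝖯M_e(x)|`. [folklore] -/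
theorem retr_near
    (Q : GaugeConfig 3 L (Matrix.specialUnitaryGroup (Fin 2) ℂ)) (x : Edge 3 L × Fin 2 × Fin 2 × Bool → ℝ) :
    let coords : GaugeConfig 3 L (Matrix.specialUnitaryGroup (Fin 2) ℂ) → (Edge 3 L × Fin 2 × Fin 2 × Bool → ℝ) :=
      fun V q => (fun z : ℂ => if q.2.2.2 then z.im else z.re) ((fundamentalRep (Fin 2) (V q.1) : Matrix (Fin 2) (Fin 2) ℂ) q.2.1 q.2.2.1)
    let rebuild : (Edge 3 L × Fin 2 × Fin 2 × Bool → ℝ) → Edge 3 L → Matrix (Fin 2) (Fin 2) ℂ :=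
      fun x e => Matrix.of fun i j : Fin 2 => ((x (e, i, j, false) : ℝ) : ℂ) + ((x (e, i, j, true) : ℝ) : ℂ) * Complex.I
    let qP : Matrix (Fin 2) (Fin 2) ℂ → Matrix (Fin 2) (Fin 2) ℂ := fun M =>
      !![(M 0 0 + conj (M 1 1)) / 2, (M 0 1 - conj (M 1 0)) / 2; -conj ((M 0 1 - conj (M 1 0)) / 2), conj ((M 0 0 + conj (M 1 1)) / 2)]
    let retr : (Edge 3 L × Fin 2 × Fin 2 × Bool → ℝ) → GaugeConfig 3 L (Matrix.specialUnitaryGroup (Fin 2) ℂ) := fun x e =>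
      if h : hsForm 2 (qP (rebuild x e)) (qP (rebuild x e)) ≠ 0 then
        ⟨(Real.sqrt 2 / Real.sqrt (hsForm 2 (qP (rebuild x e)) (qP (rebuild x e)))) • qP (rebuild x e),
          normalize_quatProj_mem_specialUnitaryGroup_two (rebuild x e) h⟩
      else 1
    let cut : (Edge 3 L × Fin 2 × Fin 2 × Bool → ℝ) → ℝ := fun x =>
      ∏ e : Edge 3 L, Real.smoothTransition (8 * hsForm 2 (qP (rebuild x e)) (qP (rebuild x e)) - 1)
    ‖x - coords Q‖ ≤ 1 / 4 →
      (∀ e : Edge 3 L, 1 / 2 ≤ hsForm 2 (qP (rebuild x e)) (qP (rebuild x e))) ∧ cut x = 1 ∧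
      (∀ e : Edge 3 L, ((retr x e : Matrix.specialUnitaryGroup (Fin 2) ℂ) : Matrix (Fin 2) (Fin 2) ℂ) =
        (Real.sqrt 2 / Real.sqrt (hsForm 2 (qP (rebuild x e)) (qP (rebuild x e)))) • qP (rebuild x e)) := by
  intro coords rebuild qP retr cut hx
  have hhalf : ∀ e : Edge 3 L, 1 / 2 ≤ hsForm 2 (qP (rebuild x e)) (qP (rebuild x e)) := by
    intro e
    obtain ⟨-, -, hlow⟩ := quatProj_rebuild_near Q x hx e
    have h2 : Real.sqrt 2 * (1 - 2 * (1 / 4)) = Real.sqrt 2 / 2 := by ring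
    rw [h2] at hlow
    have h0 : 0 ≤ Real.sqrt 2 / 2 := by positivity
    have hsq := pow_le_pow_left₀ h0 hlow 2
    rw [Real.sq_sqrt (hsForm_self_nonneg _), div_pow, Real.sq_sqrt (by norm_num : (0:ℝ) ≤ 2)] at hsq
    linarith
  refine ⟨hhalf, ?_, fun e => ?_⟩
  · -- every factor of the cut-off is `1`
    change ∏ e : Edge 3 L, Real.smoothTransition (8 * hsForm 2 (qP (rebuild x e)) (qP (rebuild x e)) - 1) = 1
    refine Finset.prod_eq_one fun e _ => Real.smoothTransition.one_of_one_le ?_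
    linarith [hhalf e]
  · have hne : hsForm 2 (qP (rebuild x e)) (qP (rebuild x e)) ≠ 0 := by linarith [hhalf e]
    change (((if h : hsForm 2 (qP (rebuild x e)) (qP (rebuild x e)) ≠ 0 then
        (⟨(Real.sqrt 2 / Real.sqrt (hsForm 2 (qP (rebuild x e)) (qP (rebuild x e)))) • qP (rebuild x e),
          normalize_quatProj_mem_specialUnitaryGroup_two (rebuild x e) h⟩ : Matrix.specialUnitaryGroup (Fin 2) ℂ)
      else 1) : Matrix.specialUnitaryGroup (Fin 2) ℂ) : Matrix (Fin 2) (Fin 2) ℂ) = _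
    rw [dif_pos hne]

/-- ★ **`π(coords Q) = Q`** and hence `F̃(coords Q) = F(Q)`. [folklore] -/
theorem ext_coords (F : GaugeConfig 3 L (Matrix.specialUnitaryGroup (Fin 2) ℂ) → ℝ)
    (Q : GaugeConfig 3 L (Matrix.specialUnitaryGroup (Fin 2) ℂ)) :
    let coords : GaugeConfig 3 L (Matrix.specialUnitaryGroup (Fin 2) ℂ) → (Edge 3 L × Fin 2 × Fin 2 × Bool → ℝ) :=
      fun V q => (fun z : ℂ => if q.2.2.2 then z.im else z.re) ((fundamentalRep (Fin 2) (V q.1) : Matrix (Fin 2) (Fin 2) ℂ) q.2.1 q.2.2.1)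
    let rebuild : (Edge 3 L × Fin 2 × Fin 2 × Bool → ℝ) → Edge 3 L → Matrix (Fin 2) (Fin 2) ℂ :=
      fun x e => Matrix.of fun i j : Fin 2 => ((x (e, i, j, false) : ℝ) : ℂ) + ((x (e, i, j, true) : ℝ) : ℂ) * Complex.I
    let qP : Matrix (Fin 2) (Fin 2) ℂ → Matrix (Fin 2) (Fin 2) ℂ := fun M =>
      !![(M 0 0 + conj (M 1 1)) / 2, (M 0 1 - conj (M 1 0)) / 2; -conj ((M 0 1 - conj (M 1 0)) / 2), conj ((M 0 0 + conj (M 1 1)) / 2)]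
    let retr : (Edge 3 L × Fin 2 × Fin 2 × Bool → ℝ) → GaugeConfig 3 L (Matrix.specialUnitaryGroup (Fin 2) ℂ) := fun x e =>
      if h : hsForm 2 (qP (rebuild x e)) (qP (rebuild x e)) ≠ 0 then
        ⟨(Real.sqrt 2 / Real.sqrt (hsForm 2 (qP (rebuild x e)) (qP (rebuild x e)))) • qP (rebuild x e),
          normalize_quatProj_mem_specialUnitaryGroup_two (rebuild x e) h⟩
      else 1
    let cut : (Edge 3 L × Fin 2 × Fin 2 × Bool → ℝ) → ℝ := fun x =>
      ∏ e : Edge 3 L, Real.smoothTransition (8 * hsForm 2 (qP (rebuild x e)) (qP (rebuild x e)) - 1)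
    retr (coords Q) = Q ∧ cut (coords Q) * F (retr (coords Q)) = F Q := by
  intro coords rebuild qP retr cut
  have hx : ‖coords Q - coords Q‖ ≤ 1 / 4 := by simp
  obtain ⟨-, hcut, -⟩ := retr_near Q (coords Q) hx
  have hretr : retr (coords Q) = Q := by
    funext e
    apply Subtype.ext
    have hP : qP (rebuild (coords Q) e) = (fundamentalRep (Fin 2) (Q e) : Matrix (Fin 2) (Fin 2) ℂ) := by
      have h' : rebuild (coords Q) e = (fundamentalRep (Fin 2) (Q e) : Matrix (Fin 2) (Fin 2) ℂ) := rebuild_coords_two Q e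
      rw [h']; exact quatProj_coe_two (Q e)
    have hne : hsForm 2 (qP (rebuild (coords Q) e)) (qP (rebuild (coords Q) e)) ≠ 0 := by
      rw [hP, hsForm_self_fundamentalRep]; norm_num
    change (((if h : hsForm 2 (qP (rebuild (coords Q) e)) (qP (rebuild (coords Q) e)) ≠ 0 then
        (⟨(Real.sqrt 2 / Real.sqrt (hsForm 2 (qP (rebuild (coords Q) e)) (qP (rebuild (coords Q) e)))) • qP (rebuild (coords Q) e),
          normalize_quatProj_mem_specialUnitaryGroup_two (rebuild (coords Q) e) h⟩ : Matrix.specialUnitaryGroup (Fin 2) ℂ)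
      else 1) : Matrix.specialUnitaryGroup (Fin 2) ℂ) : Matrix (Fin 2) (Fin 2) ℂ) = _
    rw [dif_pos hne]
    change (Real.sqrt 2 / Real.sqrt (hsForm 2 (qP (rebuild (coords Q) e)) (qP (rebuild (coords Q) e)))) • qP (rebuild (coords Q) e) = _
    rw [hP, hsForm_self_fundamentalRep, div_self (Real.sqrt_ne_zero'.2 (by norm_num : (0:ℝ) < 2)), one_smul]
    rfl
  have hcut' : cut (coords Q) = 1 := hcut
  exact ⟨hretr, by rw [hcut', hretr, one_mul]⟩

end Summit.QuantumFields.YangMills.Theorems.ColdStartUniversality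

end
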